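import Summits.BirchSwinnertonDyer.BirchSwinnertonDyer.Theorems.MordellShaFreeCutThreeAdicBDPExistsValue
import Summits.BirchSwinnertonDyer.Rank1Residual.X11b.LambdaSupplyPrime
import Summits.BirchSwinnertonDyer.Rank1Residual.X11b.EmbeddingDatumPrime
import Literature.NumberTheory.EllipticCurves.Hsieh2014.AnticyclotomicPAdicLFunctionAnyLevel
import Literature.FieldTheory.AlgClosed.PadicAlgClEquivComplex

set_option linter.dupNamespace false
set_option autoImplicit false

/-! # Route `MordellShaFreeCut` (rung S2b) — (LB-exist) at the additive prime `3` SPLIT into PRINT and its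
NAMED RESIDUAL: `ThreeAdicBDPElementExists` ⟸ Hsieh 2014 Thm A at any level (the Literature fact
`Hsieh2014.thmA_exists_isHsiehLFunction_unrPeriod_anyLevel`, p479919) + the λ-supply (TREE THEOREM) + an
embedding datum (TREE THEOREM) + ONE typed descent statement `ThreeAdicHsiehDescent` (OPEN: the
`R₀`-rationality of Hsieh's re-normalised element at `3² ∣ N`)

Cell `bsd-cn100`, prover seat `bsd-cn100-s2b-c3` (g7). Supports, does not close,
stmt-BirchSwinnertonDyer-19160; serves the BDP line on stmt-BirchSwinnertonDyer-19159 (v6bp / v6bq). Plan g15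
RULING 2026-08-27T00:41:17Z (3) fixed the LABEL of S2b's (LB-exist) after ty g9's FRAME-GAP finding
(00:29:47Z): «PRINT (Hsieh 2014 Thm A in 𝒪_{ℂ₃}⟦T⟧, modulo (T1)) + OPEN/WRITTEN (R₀-DESCENT of Q and C at
3² ∣ N — the x11b3 `HsiehDescentAtThree`-type residual, written by MEMO-transfer-13 §3.3.1/§6 as transplant) +
kernel translation», OPTION (a): the exact `R₀⟦T⟧` frame stays the currency, «the descent is the NAMED
RESIDUAL INSIDE (LB-exist)». THIS FILE MAKES THAT LABEL A KERNEL OBJECT: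

* §1 `ThreeAdicHsiehDescent` (`@[conjecture] def`, OPEN, nothing asserted) — the PURE DESCENT statement on the
  data of `ThreeAdicBDPElementExists`: for every embedding datum `ι'` inducing `v` and every Hsieh witness
  `(A > 0, Ω_K ≠ 0, C with ‖ι'⁻¹C‖ = 1, Ω_p ∈ R₀ˣ, Q ∈ 𝒪_{ℂ₃}⟦T⟧)` with `IsHsiehLFunction ι' v κ γ Dt.f A Ω_K C Ω_p Q`
  (the conclusion of the Literature fact, verbatim) there is an `R₀`-frame `(Ω_K' ≠ 0, Ω_p' ∈ R₀ˣ, 𝓛 ∈ R₀⟦T⟧)` with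
  Castella's interpolation property `IsBDPLFunction ι' v κ γ Dt.f Ω_K' Ω_p' 𝓛` — the `j = 0` / additive-`3`
  twin of team x11b3's `…X11b.Three.HsiehDescentAt₃` (there at `3 ∥ N`, their crux item 19108, split into
  Tate–Sen vanishing + open value reciprocity); `threeAdicHsiehDescent_of_forall_frame` — calibration: frames at
  every inducing `ι'` imply it outright (the witness is then not used);
* §2 **`threeAdicBDPElementExists_of_anyLevel_of_descent (hT1) (hD) : ThreeAdicBDPElementExists`** (PROVED):
  an embedding datum inducing `v` EXISTS (`X11b.exists_datum_forall_mem_iff` over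
  `PadicAlgCl.nonempty_ringEquiv_complex`), the auxiliary `λ` EXISTS (`X11b.lambdaSupplyAt`, x11b3's S24-a
  class-field-theory supply at every odd prime), Hsieh's hypotheses are read off the stub's data (`3 ≠ 2`,
  `IsNewform0 Dt.f` from `Dt.isNewformOf`, imaginary quadratic, `3` split, `3 ∈ v`, the compatibility
  clause, the Heegner hypothesis, `κ` anticyclotomic with generator `γ`), the fact `hT1` delivers the witness,
  the descent `hD` the `R₀`-frame;
* §3 censuses: `bdpExistsWithValue_of_anyLevel_of_descent_of_value` (EV∃ ⟸ (T1) + descent + the ∀-frame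
  value statement) and **`cruxB_of_anyLevel_of_descent`** — crux B `AnalyticRankOneOfRankOneFiniteShaThree` ⟸
  (T1) [citation-borne, reads owed] + `ThreeAdicHsiehDescent` [OPEN] + (LB-bdp) ∀-frame [WRITTEN for one frame,
  ∀-form ⟸ one frame at every ι′, p479337] + (LB-wan) [research] + six refereed facts.

So, in the kernel: the existence half of the S2b BDP road costs exactly ONE typed descent statement beyond
print. HONEST FRAMING: CONDITIONAL reductions + one NAMED open statement; nothing here proves the descent,
(LB-wan), (LB-bdp), crux A, crux B, the leaf, Sylvester's conjecture or any case of BSD. PARTITION: none — RANK axis.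

[cite: Hsieh2014, Thm. A p. 712 (Doc. Math. 19) = Thm. 1 (arXiv:1112.1580 pp. 3–4) (the antecedent's frame; printed for p ∤ N², extended by (T1)'s reading; the R₀-descent at 3² ∣ N is NOT in print)]
[cite: CastellaHsieh2018, Def. 3.5 and Prop. 3.6 (arXiv:1505.08165 pp. 10–11) (shape of the consequent, printed for p ∤ N)]
[cite: Castella2018, Thm. 3.1 (arXiv:1704.06608 p. 9) (shape of the consequent, printed for p ≥ 5, p ∥ N)]
[cite: deShalit1987, II.4.11 Remark (iii) (p. 66) (Ω_p may be taken a unit of the completion of ℚ_p^ur)] -/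

noncomputable section

open scoped Classical

namespace Summit.BirchSwinnertonDyer.BirchSwinnertonDyer.Theorems.MordellShaFreeCutThreeAdicHsiehDescent

open PowerSeries WeierstrassCurve NumberField IsDedekindDomain Field Literature.NumberTheory.EllipticCurves
  Literature.NumberTheory.EllipticCurves.ModularForms Literature.NumberTheory.QuadraticFields
  Literature.NumberTheory.EllipticCurves.Castella2018
open Literature.NumberTheory.GaloisRepresentations Literature.NumberTheory.GaloisCohomology
open Summit.BirchSwinnertonDyer.BirchSwinnertonDyer.Theses.MordellShaFreeCut
open Summit.BirchSwinnertonDyer.BirchSwinnertonDyer.Theorems.MordellShaFreeCutThreeAdicBDPTriple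
  (ThreeAdicBDPElementExists ThreeAdicWanDivisibility ThreeAdicBDPValueAtOne)
open Summit.BirchSwinnertonDyer.BirchSwinnertonDyer.Theorems.MordellShaFreeCutThreeAdicBDPExistsValue
  (ThreeAdicBDPElementExistsWithValue bdpExistsWithValue_of_exists_of_value cruxB_of_bdpExistsValue)

/-! ## 1. The descent statement (OPEN; named, nothing asserted) and its calibration -/

/-- **The `R₀`-DESCENT of Hsieh's anticyclotomic `p`-adic `L`-function for the newform of a `j = 0` curve at
the additive prime `3`** — the named residual INSIDE (LB-exist) (plan g15 RULING 2026-08-27T00:41:17Z (3)).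
On the data of `ThreeAdicBDPElementExists` (`W/ℚ` globally minimal elliptic with `j = 0`, `K` imaginary
quadratic with the Heegner hypothesis for `N = N(W)` and `3 = v v̄` split, `κ` the anticyclotomic
`ℤ₃`-extension with topological generator `γ`, `Dt` a modular parametrisation of level `N`): for EVERY
embedding datum `ι' : ℚ̄₃ ≃ ℂ` inducing `v` (Castella's compatibility clause at every infinite place) and EVERY
Hsieh witness `(A, Ω_K, C, Ω_p, Q)` — `0 < A`, `Ω_K ≠ 0`, `‖ι'⁻¹C‖ = 1`, `Ω_p ∈ R₀ˣ`,
`IsHsiehLFunction ι' v κ γ Dt.f A Ω_K C Ω_p Q` with `Q ∈ 𝒪_{ℂ₃}⟦T⟧`, VERBATIM the conclusion of the Literature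
fact `Hsieh2014.thmA_exists_isHsiehLFunction_unrPeriod_anyLevel` — there is an `R₀`-frame `Ω_K' ≠ 0`,
`Ω_p' ∈ R₀ˣ`, `𝓛 ∈ R₀⟦T⟧` with Castella's interpolation property `IsBDPLFunction ι' v κ γ Dt.f Ω_K' Ω_p' 𝓛`, i.e.
"Hsieh's element `Q = [g]⁻¹·Tw(𝒫_Σ(π_f, λ)²) ∈ Z̄₃⟦Γ⁻⟧`, its unit constant `C` and the archimedean monomial are,
up to an admissible re-normalisation of the periods, `R₀ = 𝒪(ℚ̂₃^ur)`-rational". PRINTED only by Castella–Hsieh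
2018 Def. 3.5 / Prop. 3.6 (`p ∤ N`) and Castella 2018 Thm. 3.1 (`p ≥ 5`, `p ∥ N`); at `3² ∣ N` NOT in print
(written as a transplant in the cell's MEMO-transfer-13 §3.3.1/§6: the W-valued form of CH18 Def. 3.5); the
`3 ∥ N` twin is team x11b3's `…Rank1Residual.X11b.Three.HsiehDescentAt₃` (their crux, split into Tate–Sen
vanishing + open value reciprocity). A PURE DESCENT statement; TYPED, not attempted; nothing asserted.
[cite: Hsieh2014, Thm. A p. 712 = Thm. 1 (arXiv:1112.1580 pp. 3–4) (frame of the antecedent; the R₀-descent at 3² ∣ N is NOT in print)]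
[cite: CastellaHsieh2018, Def. 3.5 and Prop. 3.6 (shape of the consequent, printed for p ∤ N)]
[cite: deShalit1987, II.4.11 Remark (iii) (p. 66) (Ω_p a unit of the completion of ℚ_p^ur)] -/
@[conjecture] def ThreeAdicHsiehDescent : Prop :=
  ∀ (W : WeierstrassCurve ℚ) [W.IsElliptic] [W.IsGloballyMinimal], W.j = 0 →
    ∀ (K : Type) [Field K] [NumberField K] (N : ℕ) [NeZero N]
      (Dt : ModularParametrizationData W N)
      (v : HeightOneSpectrum (𝓞 K)) (κ : ZpExtension K 3) (γ : absoluteGaloisGroup K)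
      [Fact (κ.IsTopGenerator γ)],
    W.conductorNorm ℤ = N → IsImaginaryQuadratic K →
    SatisfiesHeegnerHypothesis N K → ((Ideal.span {(3 : ℤ)}).primesOver (𝓞 K)).ncard = 2 →
    ((3 : ℕ) : 𝓞 K) ∈ v.asIdeal → κ.IsAnticyclotomic →
    ∀ (ι' : PadicAlgCl 3 ≃+* ℂ),
      (∀ (w : InfinitePlace K) (k : 𝓞 K), k ∈ v.asIdeal ↔ ‖ι'.symm (w.embedding (k : K))‖ < 1) →
    ∀ (A : ℝ) (ΩK C : ℂ) (Ωp : (unrIntegers 3)ˣ) (Q : PowerSeries (PadicComplexInt 3)),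
      0 < A → ΩK ≠ 0 → ‖((ι'.symm C : PadicAlgCl 3) : ℂ_[3])‖ = 1 →
      IsHsiehLFunction ι' v κ γ Dt.f A ΩK C ((Ωp : unrIntegers 3) : ℂ_[3]) Q →
      ∃ (ΩK' : ℂ) (Ωp' : (unrIntegers 3)ˣ) (L : UnrSeries 3),
        ΩK' ≠ 0 ∧ IsBDPLFunction ι' v κ γ Dt.f ΩK' ((Ωp' : unrIntegers 3) : ℂ_[3]) L

/-- **Calibration: `R₀`-frames at EVERY embedding datum inducing `v` imply the descent statement outright**
(the Hsieh witness is then not used) — so `ThreeAdicHsiehDescent` is AT MOST «(LB-exist) at every `ι'`»; it is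
the part of that statement which is NOT print. [folklore] -/
theorem threeAdicHsiehDescent_of_forall_frame
    (h : ∀ (W : WeierstrassCurve ℚ) [W.IsElliptic] [W.IsGloballyMinimal], W.j = 0 →
      ∀ (K : Type) [Field K] [NumberField K] (N : ℕ) [NeZero N]
        (Dt : ModularParametrizationData W N)
        (v : HeightOneSpectrum (𝓞 K)) (κ : ZpExtension K 3) (γ : absoluteGaloisGroup K)
        [Fact (κ.IsTopGenerator γ)],
      W.conductorNorm ℤ = N → IsImaginaryQuadratic K →
      SatisfiesHeegnerHypothesis N K → ((Ideal.span {(3 : ℤ)}).primesOver (𝓞 K)).ncard = 2 →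
      ((3 : ℕ) : 𝓞 K) ∈ v.asIdeal → κ.IsAnticyclotomic →
      ∀ (ι' : PadicAlgCl 3 ≃+* ℂ),
        (∀ (w : InfinitePlace K) (k : 𝓞 K), k ∈ v.asIdeal ↔ ‖ι'.symm (w.embedding (k : K))‖ < 1) →
        ∃ (ΩK' : ℂ) (Ωp' : (unrIntegers 3)ˣ) (L : UnrSeries 3),
          ΩK' ≠ 0 ∧ IsBDPLFunction ι' v κ γ Dt.f ΩK' ((Ωp' : unrIntegers 3) : ℂ_[3]) L) :
    ThreeAdicHsiehDescent := by
  intro W _ _ hj K _ _ N _ Dt v κ γ _ hN hK hHN hsplit hv3 hκ ι' hι' A ΩK C Ωp Q _ _ _ _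
  exact h W hj K N Dt v κ γ hN hK hHN hsplit hv3 hκ ι' hι'

/-! ## 2. (LB-exist) from the Literature fact, the λ-supply, an embedding datum and the descent -/

/-- **(LB-exist) `ThreeAdicBDPElementExists` ⟸ Hsieh 2014 Thm A at any level (`hT1`, the Literature fact
`Hsieh2014.thmA_exists_isHsiehLFunction_unrPeriod_anyLevel`, p479919 — citation-borne, reads owed) + the
descent statement `ThreeAdicHsiehDescent` (`hD`, OPEN).** Everything else is PROVED in the tree: an embedding
datum `ι'` inducing the given `v ∋ 3` EXISTS (`PadicAlgCl.nonempty_ringEquiv_complex` + `X11b.exists_datum_forall_mem_iff`: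
`ι₀` or `ι₀ ∘ conj`); the auxiliary anticyclotomic `λ` of Hsieh's theorem (unitary, infinity type `(1, −1)`,
trivial on `𝔸_ℚˣ`, unramified outside `3`, avatar through `κ`) EXISTS (`X11b.lambdaSupplyAt`, x11b3's S24-a
supply by class field theory at every odd prime); Hsieh's standing hypotheses are the stub's data (`3 ≠ 2`,
`IsNewform0 Dt.f` from `Dt.isNewformOf`, `K` imaginary quadratic, `3` split, `3 ∈ v`, the compatibility clause,
the Heegner hypothesis for `N`, `κ` anticyclotomic, `γ` a topological generator). CONDITIONAL on `hT1` and `hD`;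
credits nothing beyond the reduction. [cite: Hsieh2014, Thm. A p. 712 = Thm. 1 (arXiv:1112.1580 pp. 3–4)]
[cite: Washington1997, §13.1 (anticyclotomic characters; the λ-supply)] -/
theorem threeAdicBDPElementExists_of_anyLevel_of_descent
    (hT1 : Hsieh2014.thmA_exists_isHsiehLFunction_unrPeriod_anyLevel) (hD : ThreeAdicHsiehDescent) :
    ThreeAdicBDPElementExists := by
  intro W _ _ hj K _ _ N _ Dt v κ γ hγ hN hK hHN hsplit hv3 hκ
  haveI : Fact (Nat.Prime 3) := ⟨Nat.prime_three⟩
  -- an embedding datum inducing `v`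
  obtain ⟨ι₀⟩ := PadicAlgCl.nonempty_ringEquiv_complex 3
  obtain ⟨ι', -, hι'⟩ :=
    Summit.BirchSwinnertonDyer.Rank1Residual.X11b.exists_datum_forall_mem_iff 3 ι₀ hK hv3
  -- the auxiliary anticyclotomic character `λ` of Hsieh's theorem (class field theory, a tree theorem)
  obtain ⟨lam, rlam, hunit, hinfl, hAQ, hunrl, havl, hfacl⟩ :=
    Summit.BirchSwinnertonDyer.Rank1Residual.X11b.lambdaSupplyAt (p := 3) (by norm_num) ι' K κ hK hκ
  -- Hsieh 2014 Thm A at any level: the witness in `𝒪_{ℂ₃}⟦T⟧`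
  obtain ⟨A, ΩK, C, Ωp, Q, hA, hΩK, hC, hQ⟩ :=
    hT1 ι' K v κ γ Dt.f lam rlam (by norm_num) Dt.isNewformOf.1 hK hsplit hv3 hι' hHN hunit hinfl hAQ
      hunrl havl hfacl hκ hγ.out
  -- the descent: an `R₀`-frame with Castella's interpolation property
  obtain ⟨ΩK', Ωp', L, hΩK', hL⟩ :=
    hD W hj K N Dt v κ γ hN hK hHN hsplit hv3 hκ ι' hι' A ΩK C Ωp Q hA hΩK hC hQ
  exact ⟨ι', hι', ΩK', Ωp', L, hΩK', hL⟩

/-! ## 3. Censuses: what the BDP road of S2b rests on, with (LB-exist) split into print + descent -/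

/-- **EV∃ `ThreeAdicBDPElementExistsWithValue` ⟸ (T1) + descent + the ∀-frame value statement (LB-bdp)**
(calibration `bdpExistsWithValue_of_exists_of_value` over §2). CONDITIONAL; credits nothing.
[cite: Castella2018, Thm. 3.1 and Thm. 3.2 (shape; nothing asserted at 3 ∣ N)] -/
theorem bdpExistsWithValue_of_anyLevel_of_descent_of_value
    (hT1 : Hsieh2014.thmA_exists_isHsiehLFunction_unrPeriod_anyLevel) (hD : ThreeAdicHsiehDescent)
    (hV : ThreeAdicBDPValueAtOne) : ThreeAdicBDPElementExistsWithValue :=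
  bdpExistsWithValue_of_exists_of_value (threeAdicBDPElementExists_of_anyLevel_of_descent hT1 hD) hV

/-- **KERNEL CENSUS OF CRUX B with (LB-exist) SPLIT: `AnalyticRankOneOfRankOneFiniteShaThree` ⟸ Hsieh 2014 Thm A
at any level (`hT1`, citation-borne) + `ThreeAdicHsiehDescent` (`hD`, OPEN — the named residual) + (LB-bdp)
∀-frame (`hV`; ⟸ one frame with its value at every `ι'`, p479337) + (LB-wan) (`hWan`, research) + six refereed
facts** (`3`-parity, modularity, Hoffstein–Luo, Kato, existence of Heegner points, Gross–Zagier + Kolyvagin) — via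
`cruxB_of_bdpExistsValue` (p478070; Link A and Poitou–Tate are tree theorems). CONDITIONAL; credits nothing; BSD
and Sylvester's conjecture untouched. [cite: CastellaGrossiLeeSkinner2022, §5.2 (proof of Thm. 5.2.1)]
[cite: GrossZagier1986, Thm. I.6.3 with V.§2] [cite: Hsieh2014, Thm. A p. 712 = Thm. 1 (arXiv:1112.1580 pp. 3–4)] -/
theorem cruxB_of_anyLevel_of_descent
    (hpar : ∀ (W : WeierstrassCurve ℚ) [W.IsElliptic] (p : ℕ) [Fact p.Prime], p_parity W p)
    (hmod : ModularForms.exists_isNewformOf) (hHL : HoffsteinLuo1997_exists_twist_L_one_ne_zero)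
    (hKato : ∀ (W : WeierstrassCurve ℚ) [W.IsElliptic] (p : ℕ) [Fact p.Prime],
      kato_finite_of_L_one_ne_zero W p)
    (hHP : ∀ (W : WeierstrassCurve ℚ) (K : Type) [Field K] [NumberField K],
      exists_isHeegnerPoint W K)
    (hGZ : ∀ (W : WeierstrassCurve ℚ) (N : ℕ) [NeZero N] (K : Type) [Field K] [NumberField K],
      analyticRankEK_eq_one_iff_heegner_nonTorsion W N K)
    (hT1 : Hsieh2014.thmA_exists_isHsiehLFunction_unrPeriod_anyLevel) (hD : ThreeAdicHsiehDescent)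
    (hV : ThreeAdicBDPValueAtOne) (hWan : ThreeAdicWanDivisibility) :
    AnalyticRankOneOfRankOneFiniteShaThree :=
  cruxB_of_bdpExistsValue hpar hmod hHL hKato hHP hGZ
    (bdpExistsWithValue_of_anyLevel_of_descent_of_value hT1 hD hV) hWan

end Summit.BirchSwinnertonDyer.BirchSwinnertonDyer.Theorems.MordellShaFreeCutThreeAdicHsiehDescent

end
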